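import Mathlib
import Literature.Geometry.Lorentzian.KerrConvergence
import Literature.Geometry.Lorentzian.KerrSchildEnergyEstimate
import HarnessLib

/-!
# MovingShellCutoff

Topic `Literature/Uncategorized`. Named literature fact(s) relocated by the gate from `Summits/FinalStateConjecture/FinalStateConjecture/Theorems/StarvedNecksNeckGapDecayStubMovingShellCutoff.lean`
(accept-time relocation of `[cite]`d propositions written inline in a Summits proposal; human ruling 2026-08-15).

* `Literature.Uncategorized.MovingShellCutoff`
-/

namespace Literature.Uncategorized

open scoped ContDiff Topology
open Set Filter Literature.Geometry.Lorentzian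

/-- **W3 — moving two-sided shell cut-off** (analysis on `E4`).  For a motion `(Λ, c)` and a smooth
slow radius profile `ϱ ≥ 1` (`|ϱ′|, |ϱ″|, |ϱ‴| ≤ 1`) there is a `C^∞` function `χ : E4 → [0, 1]` of
the lab point `x`, with rest-frame data `z = Λ⁻¹(x − c)`, `s = ‖z⃗‖` (`E4.spatialNorm`), `t = z⁰`:
`χ = 0` where `s ≤ ϱ(t) + 3/2` or `s ≥ ϱ(t) + 7/2`, `χ = 1` where `ϱ(t) + 2 ≤ s ≤ ϱ(t) + 3`, and
ALL derivatives of `χ` of order `≤ 3` are bounded on `E4` by one constant `G` (`χ = b(s − ϱ(t))`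
for a fixed bump `b`; the Euclidean norm has bounded derivatives of every order on `{s ≥ 1}` by
homogeneity, `ϱ ∘ t` by the slowness of `ϱ`, and `z` is affine in `x`). [folklore] -/
def MovingShellCutoff : Prop :=
  ∀ (Λ : lorentzGroup) (c : E4) (ϱ : ℝ → ℝ), ContDiff ℝ ∞ ϱ → (∀ u, 1 ≤ ϱ u) →
    (∀ u, |deriv ϱ u| ≤ 1) → (∀ u, |iteratedDeriv 2 ϱ u| ≤ 1) → (∀ u, |iteratedDeriv 3 ϱ u| ≤ 1) →
    ∃ (χ : E4 → ℝ) (G : ℝ), ContDiff ℝ ∞ χ ∧ (∀ x, 0 ≤ χ x ∧ χ x ≤ 1) ∧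
      (∀ x, E4.spatialNorm (poincareInv Λ c x) ≤ ϱ (poincareInv Λ c x 0) + 3 / 2 → χ x = 0) ∧
      (∀ x, ϱ (poincareInv Λ c x 0) + 7 / 2 ≤ E4.spatialNorm (poincareInv Λ c x) → χ x = 0) ∧
      (∀ x, ϱ (poincareInv Λ c x 0) + 2 ≤ E4.spatialNorm (poincareInv Λ c x) →
        E4.spatialNorm (poincareInv Λ c x) ≤ ϱ (poincareInv Λ c x 0) + 3 → χ x = 1) ∧
      ∀ j, j ≤ 3 → ∀ x, ‖iteratedFDeriv ℝ j χ x‖ ≤ G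

/-! ### The fixed bump `b` -/

end Literature.Uncategorized
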